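import Summits.ResolutionOfSingularities.ResolutionOfSingularities.Theorems.FrobeniusClosingPatchingRelPerfectMonomialPolyhedraGamePersistence
import Summits.ResolutionOfSingularities.ResolutionOfSingularities.Theorems.FrobeniusClosingPatchingRelPerfectMonomialPolyhedraGameClass
import HarnessLib

/-!
# Crux `PatchingRelPerfect` (stmt-ResolutionOfSingularities-16161), chain w52 — TargetsF3 (m) «M2-strong»,
# COMBINATORIAL HALF, Route F file F5a: the PHASE DRIVERS (Phase A = Goward inside `F` on the Z-class,
# Phase B = mixed centres until the class is empty)

[OURS · L1 W5.2 · background line; res-L1-w52-stub-4 g3 ROUTE-F memo §1–§2, kernel form; fact-free; nothing here is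
a statement of the manuscript under review]

Both drivers are stated in CONTINUATION form («if every state reachable with the post-condition is winnable, so is
the current state»), so that `Winnable 0` (an inductive existential) is produced move by move.  The invariant carried
along (`PAInv`): well-formedness, freeness for the current free set, the non-free index set `B \\ F` unchanged, and
NP-DESCENT (`NPDescends`: every non-principal stratum has its non-free part inside that of a non-principal stratum of
the starting state — levels never rise, emptied classes never refill).
* `phaseA` — for the class index set `T°`: reach a state in which the members of the Z-class of `T°` are pairwise
  `F`-comparable; termination by (number of incomparable Z-pairs, Goward measure of the pair being treated), each step
  `exists_gowardF_step` on a centre `{g, g'} ⊆ F`.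
* `phaseB` — from there: reach a state whose class `cls · · T°` is EMPTY; termination by `psi` (`psi_move_lt`), each
  step the mixed centre `insert f T°`; Z-comparability is preserved (`FComparable.move_mixed`).

## References

* R. Goward, *A simple algorithm for principalization of monomial ideals*, Trans. AMS 357 (2005), §2. [Goward2005]
* J. Kollár, *Lectures on Resolution of Singularities* (2007), (3.111) Step 3. [Kollar2007]
-/

-- `Summit.<Summit>.<Sub>.Theorems` with `Sub = Summit` (single-conjunct summit, D-0017)
set_option linter.dupNamespace false

namespace Summit.ResolutionOfSingularities.ResolutionOfSingularities.Theorems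

namespace PolyhedraGame

open Finset

/-! ## NP-descent and the phase invariant -/

section Invariant

/-- [OURS · W5.2 Route F] NP-DESCENT from `(s, F)` to `(s', F')`: every non-principal stratum of `s'` has its `F'`-free
part inside the `F`-free part of some non-principal stratum of `s`. -/
def NPDescends (s : State) (F : Finset ℕ) (s' : State) (F' : Finset ℕ) : Prop :=
  ∀ S' ∈ s'.Str, ¬ PrincipalAt s' S' → ∃ S ∈ s.Str, ¬ PrincipalAt s S ∧ S' \ F' ⊆ S \ F

/-- [OURS] NP-descent is reflexive. -/
theorem NPDescends.refl (s : State) (F : Finset ℕ) : NPDescends s F s F :=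
  fun S' hS' hnp => ⟨S', hS', hnp, le_rfl⟩

/-- [OURS] NP-descent is transitive. -/
theorem NPDescends.trans {s₁ s₂ s₃ : State} {F₁ F₂ F₃ : Finset ℕ} (h₁ : NPDescends s₁ F₁ s₂ F₂)
    (h₂ : NPDescends s₂ F₂ s₃ F₃) : NPDescends s₁ F₁ s₃ F₃ := by
  intro S₃ hS₃ hnp₃
  obtain ⟨S₂, hS₂, hnp₂, hsub₂⟩ := h₂ S₃ hS₃ hnp₃
  obtain ⟨S₁, hS₁, hnp₁, hsub₁⟩ := h₁ S₂ hS₂ hnp₂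
  exact ⟨S₁, hS₁, hnp₁, hsub₂.trans hsub₁⟩

/-- [OURS] **One move is an NP-descent** (the exceptional index joins the free set). -/
theorem npDescends_move {s : State} {F J : Finset ℕ} {N c : ℕ} (hs : s.WF) (hN : N ∉ s.B) :
    NPDescends s F (move s J N c) (insert N F) := by
  intro S' hS' hnp
  obtain ⟨S, hS, hnpS, hsub⟩ := exists_parent_of_not_principalAt hs hN hS' hnp
  refine ⟨S, hS, hnpS, fun i hi => ?_⟩
  rw [Finset.mem_sdiff] at hi ⊢
  have hiN : i ≠ N := fun h => hi.2 (h ▸ Finset.mem_insert_self _ _)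
  exact ⟨hsub (Finset.mem_erase.mpr ⟨hiN, hi.1⟩), fun h => hi.2 (Finset.mem_insert_of_mem h)⟩

/-- [OURS] The non-free index set is unchanged by a move with a fresh exceptional index made free. -/
theorem move_B_sdiff_insert {s : State} {F J : Finset ℕ} {N c : ℕ} (hN : N ∉ s.B) :
    (move s J N c).B \ insert N F = s.B \ F := by
  show insert N s.B \ insert N F = s.B \ F
  ext i
  simp only [Finset.mem_sdiff, Finset.mem_insert, not_or]
  constructor
  · rintro ⟨h1 | h1, h2, h3⟩
    · exact absurd h1 h2
    · exact ⟨h1, h3⟩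
  · rintro ⟨h1, h3⟩
    exact ⟨Or.inr h1, fun h => hN (h ▸ h1), h3⟩

/-- [OURS · W5.2 Route F] The invariant carried by the phase drivers, relative to a starting state `(s₀, F₀)`. -/
structure PAInv (s₀ : State) (F₀ : Finset ℕ) (s : State) (F : Finset ℕ) : Prop where
  /-- well formed -/
  wf : s.WF
  /-- `F` is free -/
  free : Free s F
  /-- the non-free indices are those of the start -/
  sdiff : s.B \ F = s₀.B \ F₀
  /-- NP-descent from the start -/
  desc : NPDescends s₀ F₀ s F

/-- [OURS] The invariant at the start. -/
theorem PAInv.start {s : State} {F : Finset ℕ} (hs : s.WF) (hF : Free s F) : PAInv s F s F :=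
  ⟨hs, hF, rfl, NPDescends.refl s F⟩

/-- [OURS] **The invariant passes along every permissible move** (fresh `N`, total transform, `N` made free). -/
theorem PAInv.move {s₀ s : State} {F₀ F J : Finset ℕ} {N : ℕ} (h : PAInv s₀ F₀ s F) (hJ : Permissible s J)
    (hN : N ∉ s.B) : PAInv s₀ F₀ (PolyhedraGame.move s J N 0) (insert N F) :=
  ⟨WF.move h.wf J N 0, h.free.move h.wf hJ hN, (move_B_sdiff_insert hN).trans h.sdiff,
    h.desc.trans (npDescends_move h.wf hN)⟩

end Invariant

/-! ## Phase A: Goward inside `F` on the Z-class of `T°` -/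

section PhaseA

variable {s₀ : State} {F₀ : Finset ℕ} (T₀ : Finset ℕ)

/-- [OURS] The incomparable ordered pairs of Z-members. -/
noncomputable def incompZ (s : State) (F : Finset ℕ) : Finset ((ℕ →₀ ℕ) × (ℕ →₀ ℕ)) := by
  classical exact ((Z s F T₀) ×ˢ (Z s F T₀)).filter fun p => ¬ FComparable s F p.1 p.2

variable {T₀}

/-- [OURS] Membership in `incompZ`. -/
theorem mem_incompZ_iff {s : State} {F : Finset ℕ} {p : (ℕ →₀ ℕ) × (ℕ →₀ ℕ)} :
    p ∈ incompZ T₀ s F ↔ p.1 ∈ Z s F T₀ ∧ p.2 ∈ Z s F T₀ ∧ ¬ FComparable s F p.1 p.2 := by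
  classical
  simp only [incompZ, Finset.mem_filter, Finset.mem_product, and_assoc]

variable (hT₀ : T₀ ⊆ s₀.B \ F₀)
include hT₀

/-- [OURS] Under the invariant, `T°` consists of live non-free indices. -/
theorem PAInv.T₀_subset {s : State} {F : Finset ℕ} (h : PAInv s₀ F₀ s F) : T₀ ⊆ s.B \ F :=
  h.sdiff.symm ▸ hT₀

/-- [OURS] After a move with fresh `N` made free, the Z-class of `T°` is the image of the old one. -/
theorem PAInv.Z_move_eq {s : State} {F J : Finset ℕ} {N : ℕ} (h : PAInv s₀ F₀ s F) (hN : N ∉ s.B) :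
    Z (PolyhedraGame.move s J N 0) (insert N F) T₀ = (Z s F T₀).image (moveExp J N 0) := by
  have hsub := h.T₀_subset hT₀
  have hT₀F : T₀ \ F = T₀ := Finset.sdiff_eq_self_iff_disjoint.mpr
    (Finset.disjoint_of_subset_left hsub Finset.sdiff_disjoint)
  refine Z_move_eq_image hN ?_ (hT₀F.symm ▸ hsub.trans Finset.sdiff_subset)
  rw [hT₀F]
  refine Finset.sdiff_eq_self_iff_disjoint.mpr (Finset.disjoint_insert_right.mpr ⟨fun hN' => hN ?_, ?_⟩)
  · exact (Finset.mem_sdiff.mp (hsub hN')).1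
  · exact Finset.disjoint_of_subset_left hsub Finset.sdiff_disjoint

/-- [OURS] **PHASE A of ROUTE-F**: from a state satisfying the invariant one reaches, by blow-ups of bad pairs
`{g, g'} ⊆ F`, a state (still satisfying the invariant) in which the Z-class of `T°` is pairwise `F`-comparable —
in continuation form. -/
theorem phaseA {s : State} {F : Finset ℕ} (h : PAInv s₀ F₀ s F)
    (K : ∀ s' F', PAInv s₀ F₀ s' F' →
      (∀ ζ ∈ Z s' F' T₀, ∀ ζ' ∈ Z s' F' T₀, FComparable s' F' ζ ζ') → Winnable 0 s') :
    Winnable 0 s := by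
  classical
  -- outer induction on the number of incomparable Z-pairs
  suffices A : ∀ n, ∀ s F, PAInv s₀ F₀ s F → (incompZ T₀ s F).card ≤ n → Winnable 0 s from
    A _ s F h le_rfl
  intro n
  induction n with
  | zero =>
    intro s F h hcard
    refine K s F h fun ζ hζ ζ' hζ' => ?_
    by_contra hnc
    have : (ζ, ζ') ∈ incompZ T₀ s F := mem_incompZ_iff.mpr ⟨hζ, hζ', hnc⟩
    rw [Finset.card_eq_zero.mp (Nat.le_zero.mp hcard)] at this
    exact Finset.notMem_empty _ this
  | succ n ihn =>
    -- inner induction on Goward's measure of a chosen incomparable pair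
    suffices B : ∀ v k, ∀ s F α β, PAInv s₀ F₀ s F → α ∈ Z s F T₀ → β ∈ Z s F T₀ → ¬ FComparable s F α β →
        (incompZ T₀ s F).card ≤ n + 1 → maxValF s F α β = v → numMaxF s F α β = k → Winnable 0 s by
      intro s F h hcard
      by_cases h0 : incompZ T₀ s F = ∅
      · exact ihn s F h (by rw [h0, Finset.card_empty]; exact Nat.zero_le _)
      · obtain ⟨p, hp⟩ := Finset.nonempty_iff_ne_empty.mpr h0
        obtain ⟨hα, hβ, hnc⟩ := mem_incompZ_iff.mp hp
        exact B _ _ s F p.1 p.2 h hα hβ hnc hcard rfl rfl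
    intro v
    induction v using Nat.strong_induction_on with
    | _ v ihv =>
    intro k
    induction k using Nat.strong_induction_on with
    | _ k ihk =>
    intro s F α β h hα hβ hnc hcard hv hk
    have hs := h.wf
    have hFB : F ⊆ s.B := h.free.subset
    have hαA : α ∈ s.A := mem_A_of_mem_Z hα
    have hβA : β ∈ s.A := mem_A_of_mem_Z hβ
    have hne : (badPairsF s F α β).Nonempty := by
      rw [Finset.nonempty_iff_ne_empty, Ne, ← fComparable_iff_badPairsF_eq_empty hs]; exact hnc
    obtain ⟨g, hg, g', hg', hgg', hstr, hstep⟩ := exists_gowardF_step hs hFB hαA hβA hne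
    set J : Finset ℕ := {g, g'} with hJ
    have hperm : Permissible s J :=
      h.free.permissible hstr ⟨g, Finset.mem_inter.mpr ⟨Finset.mem_insert_self _ _, hg⟩⟩
    have hJF : J ⊆ F := Finset.insert_subset hg (Finset.singleton_subset_iff.mpr hg')
    set N := s.B.sup id + 1 with hNdef
    have hN : N ∉ s.B := sup_succ_notMem s
    refine Winnable.step J N hperm hN ?_
    set s' := PolyhedraGame.move s J N 0 with hs'
    set F' := insert N F with hF'
    have h' : PAInv s₀ F₀ s' F' := h.move hperm hN
    have hZ' : Z s' F' T₀ = (Z s F T₀).image (moveExp J N 0) := h.Z_move_eq hT₀ hN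
    -- the incomparable Z-pairs of `s'` come from those of `s`
    have hsub : incompZ T₀ s' F' ⊆ (incompZ T₀ s F).image (Prod.map (moveExp J N 0) (moveExp J N 0)) := by
      intro p' hp'
      obtain ⟨h1, h2, hnc'⟩ := mem_incompZ_iff.mp hp'
      rw [hZ'] at h1 h2
      obtain ⟨ζ₁, hζ₁, h1⟩ := Finset.mem_image.mp h1
      obtain ⟨ζ₂, hζ₂, h2⟩ := Finset.mem_image.mp h2
      refine Finset.mem_image.mpr ⟨(ζ₁, ζ₂), mem_incompZ_iff.mpr ⟨hζ₁, hζ₂, fun hc => hnc' ?_⟩, ?_⟩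
      · rw [← h1, ← h2]
        exact hc.move_of_subset hs hN (mem_A_of_mem_Z hζ₁) (mem_A_of_mem_Z hζ₂) hJF
      · rw [Prod.map_apply, h1, h2]
    by_cases hc' : FComparable s' F' (moveExp J N 0 α) (moveExp J N 0 β)
    · -- the treated pair became comparable: the count drops
      refine ihn s' F' h' ?_
      have hsub' : incompZ T₀ s' F' ⊆
          ((incompZ T₀ s F).erase (α, β)).image (Prod.map (moveExp J N 0) (moveExp J N 0)) := by
        intro p' hp'
        obtain ⟨q, hq, hqp⟩ := Finset.mem_image.mp (hsub hp')
        refine Finset.mem_image.mpr ⟨q, Finset.mem_erase.mpr ⟨fun hqe => ?_, hq⟩, hqp⟩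
        subst hqe
        rw [Prod.map_apply] at hqp
        exact (mem_incompZ_iff.mp (hqp ▸ hp')).2.2 hc'
      calc (incompZ T₀ s' F').card
          ≤ (((incompZ T₀ s F).erase (α, β)).image (Prod.map (moveExp J N 0) (moveExp J N 0))).card :=
            Finset.card_le_card hsub'
        _ ≤ ((incompZ T₀ s F).erase (α, β)).card := Finset.card_image_le
        _ ≤ n := by
            have hmem : (α, β) ∈ incompZ T₀ s F := mem_incompZ_iff.mpr ⟨hα, hβ, hnc⟩
            have := Finset.card_erase_of_mem hmem
            omega
    · -- still incomparable: Goward's measure of the image pair dropped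
      have hcard' : (incompZ T₀ s' F').card ≤ n + 1 :=
        (Finset.card_le_card hsub).trans (Finset.card_image_le.trans hcard)
      have hα' : moveExp J N 0 α ∈ Z s' F' T₀ := hZ' ▸ Finset.mem_image_of_mem _ hα
      have hβ' : moveExp J N 0 β ∈ Z s' F' T₀ := hZ' ▸ Finset.mem_image_of_mem _ hβ
      rcases hstep N hN with hlt | ⟨heq, hlt⟩
      · exact ihv _ (hv ▸ hlt) _ s' F' _ _ h' hα' hβ' hc' hcard' rfl rfl
      · exact ihk _ (hk ▸ hlt) s' F' _ _ h' hα' hβ' hc' hcard' (heq.trans hv) rfl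

end PhaseA

/-! ## Phase B: mixed centres until the class is empty -/

section PhaseB

variable {s₀ : State} {F₀ : Finset ℕ} {T₀ : Finset ℕ} (hT₀ : T₀ ⊆ s₀.B \ F₀)
include hT₀

/-- [OURS] **PHASE B of ROUTE-F**: from a state satisfying the invariant whose Z-class of `T°` is pairwise
`F`-comparable one reaches, by blow-ups of mixed centres `insert f T°`, a state (still satisfying the invariant) whose
class `cls · · T°` is empty — in continuation form.  Termination: `psi_move_lt`. -/
theorem phaseB {s : State} {F : Finset ℕ} (h : PAInv s₀ F₀ s F)
    (hZ : ∀ ζ ∈ Z s F T₀, ∀ ζ' ∈ Z s F T₀, FComparable s F ζ ζ')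
    (K : ∀ s' F', PAInv s₀ F₀ s' F' → cls s' F' T₀ = ∅ → Winnable 0 s') :
    Winnable 0 s := by
  classical
  suffices B : ∀ p, ∀ s F, PAInv s₀ F₀ s F → (∀ ζ ∈ Z s F T₀, ∀ ζ' ∈ Z s F T₀, FComparable s F ζ ζ') →
      psi s F T₀ ≤ p → Winnable 0 s from B _ s F h hZ le_rfl
  intro p
  induction p using Nat.strong_induction_on with
  | _ p ih =>
  intro s F h hZ hp
  by_cases h0 : cls s F T₀ = ∅
  · exact K s F h h0
  obtain ⟨T, hT⟩ := Finset.nonempty_iff_ne_empty.mpr h0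
  obtain ⟨hTstr, hTF, hTnp⟩ := mem_cls_iff.mp hT
  have hs := h.wf
  have hTB : T ⊆ s.B := hs.str_subset T hTstr
  have hsub := h.T₀_subset hT₀
  have hT₀F : Disjoint T₀ F := Finset.disjoint_of_subset_left hsub Finset.sdiff_disjoint
  have hT₀self : T₀ \ F = T₀ := Finset.sdiff_eq_self_iff_disjoint.mpr hT₀F
  have hT₀T : T₀ ⊆ T := fun i hi => (Finset.mem_sdiff.mp (hTF.symm ▸ hi : i ∈ T \ F)).1
  -- the Z-class of `T` is that of `T°`, non-empty by freeness, with a Z-least member by comparability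
  have hZT : Z s F T = Z s F T₀ := Z_congr (by rw [hTF, hT₀self])
  have hne : (Z s F T).Nonempty :=
    Z_nonempty_iff.mpr (h.free.principalAt _ (hs.str_down T hTstr _ Finset.sdiff_subset) Finset.sdiff_disjoint)
  obtain ⟨ζ, hζ⟩ := exists_isZLeast hne fun μ hμ μ' hμ' =>
    hZ μ (hZT ▸ hμ) μ' (hZT ▸ hμ') T hTstr
  obtain ⟨α₀, hα₀, hα₀Z, f, hf, hviol⟩ := exists_violation_of_not_principalAt hζ hTnp
  obtain ⟨hfT, hfF⟩ := Finset.mem_inter.mp hf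
  -- the mixed centre
  set J : Finset ℕ := insert f T₀ with hJ
  have hJstr : J ∈ s.Str := hs.str_down T hTstr J (Finset.insert_subset hfT hT₀T)
  have hperm : Permissible s J := h.free.permissible hJstr ⟨f, Finset.mem_inter.mpr ⟨Finset.mem_insert_self _ _, hfF⟩⟩
  set N := s.B.sup id + 1 with hNdef
  have hN : N ∉ s.B := sup_succ_notMem s
  refine Winnable.step J N hperm hN ?_
  set s' := PolyhedraGame.move s J N 0 with hs'
  set F' := insert N F with hF'
  have h' : PAInv s₀ F₀ s' F' := h.move hperm hN
  have hZ' : Z s' F' T₀ = (Z s F T₀).image (moveExp J N 0) := h.Z_move_eq hT₀ hN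
  refine ih (psi s' F' T₀) ?_ s' F' h' ?_ le_rfl
  · exact (psi_move_lt (N := N) hs h.free hT hfT hfF hζ hα₀ hα₀Z hviol hN).trans_le hp
  · intro ζ₁' hζ₁' ζ₂' hζ₂'
    rw [hZ'] at hζ₁' hζ₂'
    obtain ⟨ζ₁, hζ₁, rfl⟩ := Finset.mem_image.mp hζ₁'
    obtain ⟨ζ₂, hζ₂, rfl⟩ := Finset.mem_image.mp hζ₂'
    refine (hZ ζ₁ hζ₁ ζ₂ hζ₂).move_mixed hs hN (mem_A_of_mem_Z hζ₁) (mem_A_of_mem_Z hζ₂) hfF hT₀F ?_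
    have := weight_eq_of_mem_Z (T := T₀) hζ₁ hζ₂
    rwa [hT₀self] at this

end PhaseB

end PolyhedraGame

end Summit.ResolutionOfSingularities.ResolutionOfSingularities.Theorems
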